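import Mathlib.RingTheory.Nakayama
import Mathlib.RingTheory.LocalRing.MaximalIdeal.Basic
import Mathlib.RingTheory.Jacobson.Ideal
import Mathlib.Algebra.Module.SpanRank
import Mathlib.RingTheory.Noetherian.Basic
import HarnessLib

/-!
# A minimal generating family of the maximal ideal is independent modulo `𝔪²`

Topic: `Literature/AlgebraicGeometry/Resolution`. Nakayama's lemma in the form consumed by the
endgame of the crux `PicoverLocalModel` (line `giraud-cossart-normal-form`): in a Noetherian
local ring `(O, 𝔪)`, if `u : ι → O` generates `𝔪` with `#ι ≤ μ(𝔪)` (the minimal number of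
generators `Submodule.spanFinrank`), then no non-trivial combination of the `u_i` lies in `𝔪²`:

  `∑ α_i u_i ∈ 𝔪²  ⇒  ∀ i, α_i ∈ 𝔪`   (`hli_of_span_eq_maximalIdeal`)

— if some `α_{i₀}` were a unit, `u_{i₀} ∈ (u_i)_{i ≠ i₀} + 𝔪·𝔪`, so by Nakayama `𝔪` would be
generated by the `#ι - 1` other elements (Matsumura, *Commutative Ring Theory*, Thm. 2.3 and
§5: `μ(𝔪) = dim_κ 𝔪/𝔪²`). This is the cotangent-independence hypothesis `hli` of the families
of boundary equations in `RegularParameterFamilies.lean`; it passes to sub-families rescaled by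
units (`hli_comp_of_injective`), which is how the simple normal crossings condition `HasSNC`
(a regular system of parameters adapted to the boundary) feeds the local algebra.

Sources: [Matsumura1987] H. Matsumura, *Commutative Ring Theory*, CUP (1987), Thm. 2.3
(Nakayama), §5 and Thm. 14.2. All statements PROVED.
-/

namespace Literature.AlgebraicGeometry.Resolution

open IsLocalRing

variable {O : Type*} [CommRing O]

/-- **Independence modulo `𝔪²` of a minimal generating family of `𝔪`** (Nakayama): in a
Noetherian local ring, if `u : ι → O` spans the maximal ideal and `#ι ≤ μ(𝔪)`, then
`∑ α_i u_i ∈ 𝔪² ⇒ α_i ∈ 𝔪` for all `i`. [cite: Matsumura1987, Thm. 2.3 and Thm. 14.2] -/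
theorem hli_of_span_eq_maximalIdeal [IsLocalRing O] [IsNoetherianRing O] {ι : Type*} [Fintype ι]
    [DecidableEq ι] (u : ι → O) (hspan : Ideal.span (Set.range u) = maximalIdeal O)
    (hcard : Fintype.card ι ≤ (maximalIdeal O).spanFinrank) :
    ∀ α : ι → O, ∑ i, α i * u i ∈ maximalIdeal O ^ 2 → ∀ i, α i ∈ maximalIdeal O := by
  intro α hα i₀
  by_contra hunit
  have hu : IsUnit (α i₀) := (IsLocalRing.notMem_maximalIdeal.mp hunit)
  -- `u_{i₀}` lies in `(u_i)_{i ≠ i₀} + 𝔪 • 𝔪`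
  let N : Ideal O := Ideal.span (u '' (Finset.univ.erase i₀ : Finset ι))
  have hN : N ≤ maximalIdeal O := by
    rw [← hspan]
    exact Ideal.span_mono (Set.image_subset_range _ _)
  have hsum : ∑ i, α i * u i = α i₀ * u i₀ + ∑ i ∈ Finset.univ.erase i₀, α i * u i :=
    (Finset.add_sum_erase _ _ (Finset.mem_univ i₀)).symm
  have hrest : ∑ i ∈ Finset.univ.erase i₀, α i * u i ∈ N :=
    Submodule.sum_mem N fun i hi =>
      Ideal.mul_mem_left _ _ (Ideal.subset_span ⟨i, by simpa using hi, rfl⟩)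
  have hui₀ : u i₀ ∈ N ⊔ maximalIdeal O • maximalIdeal O := by
    have h1 : α i₀ * u i₀ ∈ N ⊔ maximalIdeal O ^ 2 := by
      have : α i₀ * u i₀ = ∑ i, α i * u i - ∑ i ∈ Finset.univ.erase i₀, α i * u i := by
        rw [hsum]; ring
      rw [this]
      exact Ideal.sub_mem _ (Ideal.mem_sup_right hα) (Ideal.mem_sup_left hrest)
    have h2 := Ideal.mul_mem_left _ (hu.unit⁻¹ : Oˣ).1 h1
    rw [← mul_assoc, IsUnit.val_inv_mul, one_mul, pow_two, ← smul_eq_mul (a := maximalIdeal O)] at h2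
    exact h2
  -- hence `𝔪 ≤ N ⊔ 𝔪 • 𝔪`, and Nakayama gives `𝔪 = N`
  have hle : maximalIdeal O ≤ N ⊔ maximalIdeal O • maximalIdeal O := by
    conv_lhs => rw [← hspan]
    rw [Ideal.span_le]
    rintro _ ⟨i, rfl⟩
    by_cases hi : i = i₀
    · rw [hi]; exact hui₀
    · exact Ideal.mem_sup_left (Ideal.subset_span ⟨i, by simpa using hi, rfl⟩)
  have hmN : maximalIdeal O ≤ N :=
    Submodule.le_of_le_smul_of_le_jacobson_bot (IsNoetherian.noetherian _)
      (IsLocalRing.maximalIdeal_le_jacobson _) hle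
  have heq : maximalIdeal O = N := le_antisymm hmN hN
  -- count generators
  have hfin : (u '' (Finset.univ.erase i₀ : Finset ι)).Finite := Set.toFinite _
  have h1 : (maximalIdeal O).spanFinrank ≤ (u '' (Finset.univ.erase i₀ : Finset ι)).ncard := by
    rw [heq]
    exact Submodule.spanFinrank_span_le_ncard_of_finite hfin
  have h2 : (u '' (Finset.univ.erase i₀ : Finset ι)).ncard ≤ Fintype.card ι - 1 := by
    calc (u '' (Finset.univ.erase i₀ : Finset ι)).ncard
        ≤ ((Finset.univ.erase i₀ : Finset ι) : Set ι).ncard := Set.ncard_image_le (Set.toFinite _)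
      _ = Fintype.card ι - 1 := by
          rw [Set.ncard_coe_finset, Finset.card_erase_of_mem (Finset.mem_univ _), Finset.card_univ]
  have hpos : 0 < Fintype.card ι := Fintype.card_pos_iff.mpr ⟨i₀⟩
  omega

/-- **Independence passes to injective sub-families rescaled by units.** [folklore] -/
theorem hli_comp_of_injective [IsLocalRing O] {ι κ : Type*} [Fintype ι] [Fintype κ]
    [DecidableEq ι] {u : ι → O}
    (hli : ∀ α : ι → O, ∑ i, α i * u i ∈ maximalIdeal O ^ 2 → ∀ i, α i ∈ maximalIdeal O)
    (f : κ → ι) (hf : Function.Injective f) (ε : κ → O) (hε : ∀ k, IsUnit (ε k)) :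
    ∀ β : κ → O, ∑ k, β k * (ε k * u (f k)) ∈ maximalIdeal O ^ 2 → ∀ k, β k ∈ maximalIdeal O := by
  intro β hβ k₀
  -- extend the coefficients by zero along `f`
  let α : ι → O := fun i => if h : ∃ k, f k = i then β h.choose * ε h.choose else 0
  have hαf : ∀ k, α (f k) = β k * ε k := by
    intro k
    have h : ∃ k', f k' = f k := ⟨k, rfl⟩
    simp only [α, dif_pos h]
    have : h.choose = k := hf h.choose_spec
    rw [this]
  have hzero : ∀ i ∈ (Finset.univ : Finset ι), i ∉ Finset.univ.image f → α i * u i = 0 := by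
    intro i _ hi
    simp only [Finset.mem_image, Finset.mem_univ, true_and, not_exists] at hi
    simp only [α, dif_neg (not_exists.mpr hi), zero_mul]
  have hsum : ∑ i, α i * u i = ∑ k, β k * (ε k * u (f k)) := by
    rw [← Finset.sum_subset (Finset.subset_univ (Finset.univ.image f)) hzero,
      Finset.sum_image (fun a _ b _ h => hf h)]
    exact Finset.sum_congr rfl fun k _ => by rw [hαf]; ring
  have := hli α (hsum ▸ hβ) (f k₀)
  rw [hαf] at this
  exact ((IsLocalRing.maximalIdeal.isMaximal O).isPrime.mem_or_mem this).resolve_right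
    fun h => (hε k₀) |> (IsLocalRing.mem_maximalIdeal _).mp h

end Literature.AlgebraicGeometry.Resolution
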